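import Mathlib
import Summits.Ventures.PercRepro2.Defs
import Summits.Ventures.PercRepro2.Graph
import Summits.Ventures.PercRepro2.OneColourSwitch
import Summits.Ventures.PercRepro2.RegionHubSign
import Summits.Ventures.PercRepro2.SideSwitch
import Summits.Ventures.PercRepro2.SideSwitchFibre
import Summits.Ventures.PercRepro2.SideSwitchClosed
import Summits.Ventures.PercRepro2.SideSwitchComps
import Summits.Ventures.PercRepro2.SideSwitchCompsFibre
import Summits.Ventures.PercRepro2.M9NoPocketDefs
import Summits.Ventures.PercRepro2.M9NoPocketWorld
import Summits.Ventures.PercRepro2.M9NoPocketWorldD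
import Summits.Ventures.PercRepro2.M9NoPocketCompl
import Summits.Ventures.PercRepro2.M9NoPocketM9
import Summits.Ventures.PercRepro2.M9DAvoid
import Summits.Ventures.PercRepro2.M9DAvoidSplit
import Summits.Ventures.PercRepro2.M9RegionSplit
import Summits.Ventures.PercRepro2.M9HarrisCube
import Summits.Ventures.PercRepro2.M9PocketCubeDefs
import Summits.Ventures.PercRepro2.M9PocketCubeFibre
import Summits.Ventures.PercRepro2.M9PocketCubeMono
import Summits.Ventures.PercRepro2.M9PocketCubeHub
import Summits.Ventures.PercRepro2.M9PocketCubeWorldMono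
import Summits.Ventures.PercRepro2.M9PocketCubeCompl
import Summits.Ventures.PercRepro2.M9PocketCubeHarrisY
import Summits.Ventures.PercRepro2.TermSwitchDefs
import Summits.Ventures.PercRepro2.TermSwitchReach
import Summits.Ventures.PercRepro2.M9Unreached
import Summits.Ventures.PercRepro2.M9GeneralDSplit
import Summits.Ventures.PercRepro2.M9GeneralDHD
import Summits.Ventures.PercRepro2.M9LinkedHD
import Summits.Ventures.PercRepro2.M9DeadEnd
import Summits.Ventures.PercRepro2.M9DeadEndMono
import Summits.Ventures.PercRepro2.M9DeadEndHarris

/-!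
# The hub–dead-end predicate is a down-set of the pocket cube (blind cell PercRepro2, p3 g29,
2026-08-28; `proofs/P3-LINKED.md` §2 (L2), part 1)

`HubDead`: a `Sep ∧ DOne` colouring with `d ∈ K₂ ∖ M₂`, `r ~_Y s`, and a `W`-hub edge at `d`
(`hubW`, `M9RegionSplit`) or a block dead end (`deadWb`, `M9DeadEndMono`).  On the pocket cube of
a representative (`M9PocketCubeDefs`, order `x ≤ x'`: more switched blocks, more flipped free
edges) it **persists downwards** (`hubDead_assignX_anti`): `d ∈ K₂`, `d ∉ M₂`, `r ~_Y s`, `hubW`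
and `deadWb` by `M9PocketCubeWorldMono` / `M9PocketCubeHub` / `M9DeadEndMono`; `Sep` by the colour
mirror `sep2_of_not_mem_M2_of_not_hubY` (`M9DeadEndHarris`); and `DOne` — new here, WITHOUT the
edges `d–r`, `d–s` of `M9DeadEndMono.DOne_assignX_anti_of_not_mem_M2` — because a vertex doubly
reached at `x` lies in a switched block (its `W`-path avoids `d`) and is `Y`-joined to `d`
through an edge at `d` that stays `Y` upwards (`assignX_d_edge_true_of_le`: a `T`-edge turned
`W` would put `d ∈ M₂`, a block edge of an unswitched block would put its far end into the
`Y`-world of `G − d`), so it is doubly reached at `x'` (`DOne_assignX_of_le`).  Part 2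
(`M9LinkedHubSum`) sums the region.  Own work; std axioms.
-/

namespace Summit.Ventures.PercRepro2

namespace NoPocket

open Finset Classical RegionHub OneColourSwitch SideSwitch TermSwitch

variable {V : Type*} {E : Type*}

section Defs

variable {ends : E → Sym2 V} {p q r s d : V}

/-- **The hub–dead-end predicate**: `Sep ∧ DOne`, `d ∈ K₂ ∖ M₂`, `r ~_Y s`, and a `W`-hub edge or
a block dead end (`deadWb`, `M9DeadEndMono`: the `W`-cluster of `d` meets a vertex of the
`Y`-world of `G − d` other than `r, s`) at `d`. -/
def HubDead (ends : E → Sym2 V) (p q r s d : V) (ω : Config E) : Prop :=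
  sep2 ends p q r s ω ∧ DOne ends r s d ω ∧ d ∈ K2 ends r s ω ∧ d ∉ M2 ends r s ω ∧
    Conn ends ω r s ∧ (hubW ends d p q ω ∨ deadWb ends d r s ω)

end Defs

section Cube

variable [Fintype V] [DecidableEq V] [Fintype E] [DecidableEq E] {ends : E → Sym2 V}
  {p q r s d : V}

omit [Fintype E] [DecidableEq E] in
/-- Two blocks sharing a vertex coincide. -/
lemma block_eq_of_mem {ρ : Config E} {C C' : Finset V} (hC : C ∈ blocks ends d r s ρ)
    (hC' : C' ∈ blocks ends d r s ρ) {u : V} (hu : u ∈ C) (hu' : u ∈ C') : C = C' := by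
  rw [eq_compIn_of_mem_comps hC hu, eq_compIn_of_mem_comps hC' hu']

/-- A block vertex lies in the `Y`-world of `G − d` of the representative. -/
lemma mem_K2_endsD_of_mem_block {ρ : Config E} (hρ : ρ ∈ RepD ends p q r s d) {C : Finset V}
    (hC : C ∈ blocks ends d r s ρ) {u : V} (hu : u ∈ C) : u ∈ K2 (endsD ends d) r s ρ :=
  A0_subset_K2_of_mem_Rep (mem_Rep_endsD_of_mem_RepD hρ) (subset_A0_of_mem_comps hC hu)

omit [Fintype V] [DecidableEq V] [Fintype E] [DecidableEq E] in
/-- The edges at `d` have no endpoint inside `{r, s}` as a pair. -/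
lemma not_within_rs_of_d_edge (hr : d ≠ r) (hs : d ≠ s) {e : E} {u : V}
    (he : ends e = s(d, u)) : e ∉ within ends ({r, s} : Set V) := by
  rintro ⟨y, hy, z, hz, hyz⟩
  rw [he, Sym2.eq_iff] at hyz
  rcases hyz with ⟨h1, _⟩ | ⟨h1, _⟩
  · rw [← h1] at hy
    rcases hy with h | h
    · exact hr h
    · exact hs h
  · rw [← h1] at hz
    rcases hz with h | h
    · exact hr h
    · exact hs h

/-- **A `Y`-edge at `d` whose far end is outside the `Y`-world of `G − d` stays `Y` upwards**
on the cube when `d ∉ M₂` at the upper point. -/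
lemma assignX_d_edge_true_of_le (hr : d ≠ r) (hs : d ≠ s) {ρ : Config E}
    (hρ : ρ ∈ RepP ends p q r s d) {x x' : Finset (Finset V) × Finset E} (hxx' : x ≤ x')
    (hx : x ∈ cubeP ends d r s ρ) (hx' : x' ∈ cubeP ends d r s ρ) {e : E} {u : V}
    (he : ends e = s(d, u)) (hM' : d ∉ M2 ends r s (assignX ends x' ρ))
    (huK : u ∉ K2 (endsD ends d) r s (assignX ends x ρ))
    (hY : assignX ends x ρ e = true) : assignX ends x' ρ e = true := by
  obtain ⟨hρD, hρP⟩ := mem_RepP.1 hρ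
  obtain ⟨hT, hF⟩ := mem_cubeP.1 hx
  obtain ⟨hT', hF'⟩ := mem_cubeP.1 hx'
  rcases edge_trichotomy hr hs hρD e with h1 | ⟨C, hC, z, hz, w, hzw⟩ | h1
  · exact absurd h1 (not_within_rs_of_d_edge hr hs he)
  · have hzne := (block_vertex_ne hρD hC hz hr hs).2.2
    have hu : u ∈ C := by
      rw [he, Sym2.eq_iff] at hzw
      rcases hzw with ⟨h1, _⟩ | ⟨_, h1⟩
      · exact absurd h1.symm hzne
      · rw [h1]; exact hz
    rw [assignX_block_edge' hρD hT' hF' hr hs hC hu he]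
    rw [assignX_block_edge' hρD hT hF hr hs hC hu he] at hY
    by_cases hCx : C ∈ x.1
    · rw [if_pos hCx] at hY
      rw [if_pos (hxx'.1 hCx)]
      exact hY
    · -- `C` not switched at `x`: `u ∈ K₂(G − d)` at `x` — impossible
      exfalso
      apply huK
      rw [K2_endsD_assignX' hr hs hρD hT hF]
      refine ⟨mem_K2_endsD_of_mem_block hρD hC hu, ?_⟩
      intro huT
      obtain ⟨C', hC', huC'⟩ := mem_unionT.1 (Finset.mem_coe.1 huT)
      exact hCx (block_eq_of_mem hC (hT hC') hu huC' ▸ hC')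
  · rcases mem_freeE.1 h1 with hTe | hPe
    · rw [assignX_Tset hρD hT' hr hs hTe]
      rw [assignX_Tset hρD hT hr hs hTe] at hY
      obtain ⟨_, _, hρT⟩ := mem_RepD.1 hρD
      have hρe : ρ e = true := hρT e hTe
      by_cases hex' : e ∈ x'.2
      · -- the `T`-edge is `W` at `x'`: `d ∈ M₂` — impossible
        exfalso
        apply hM'
        have hdu : Conn ends (OneColourSwitch.compl (assignX ends x' ρ)) d u := by
          refine conn_of_openAdj ⟨e, ?_, he⟩
          simp only [OneColourSwitch.compl]
          rw [assignX_Tset hρD hT' hr hs hTe, if_pos hex', hρe]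
          rfl
        have hu' : u = r ∨ u = s := by
          rcases mem_Tset.1 hTe with h2 | h2 <;> rw [he, Sym2.eq_iff] at h2
          · rcases h2 with ⟨_, h3⟩ | ⟨h3, _⟩
            · exact Or.inl h3
            · exact absurd h3 hr
          · rcases h2 with ⟨_, h3⟩ | ⟨h3, _⟩
            · exact Or.inr h3
            · exact absurd h3 hs
        rcases hu' with h | h
        · rw [h] at hdu
          exact mem_M2_iff.2 (Or.inl (conn_symm hdu))
        · rw [h] at hdu
          exact mem_M2_iff.2 (Or.inr (conn_symm hdu))
      · rw [if_neg hex']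
        exact hρe
    · rw [assignX_Pk hρD hT' hPe]
      rw [assignX_Pk hρD hT hPe] at hY
      have hρe : ρ e = false := hρP e hPe
      by_cases hex : e ∈ x.2
      · rw [if_pos (hxx'.2 hex), hρe]
        rfl
      · rw [if_neg hex, hρe] at hY
        exact absurd hY (by decide)

/-- **`DOne` persists downwards** on the cube from a point with `d ∈ K₂ ∖ M₂`: a vertex doubly
reached at `x` would be doubly reached at `x'`. -/
lemma DOne_assignX_of_le (hr : d ≠ r) (hs : d ≠ s) {ρ : Config E} (hρ : ρ ∈ RepP ends p q r s d)
    {x x' : Finset (Finset V) × Finset E} (hxx' : x ≤ x') (hx : x ∈ cubeP ends d r s ρ)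
    (hx' : x' ∈ cubeP ends d r s ρ) (hK' : d ∈ K2 ends r s (assignX ends x' ρ))
    (hM' : d ∉ M2 ends r s (assignX ends x' ρ)) (hM : d ∉ M2 ends r s (assignX ends x ρ))
    (hD' : DOne ends r s d (assignX ends x' ρ)) : DOne ends r s d (assignX ends x ρ) := by
  obtain ⟨hρD, _⟩ := mem_RepP.1 hρ
  obtain ⟨hT, hF⟩ := mem_cubeP.1 hx
  obtain ⟨hT', hF'⟩ := mem_cubeP.1 hx'
  intro v hvr hvs hvd hvK hvM
  -- `v ∈ M₂(G)` at `x` gives `v ∈ M₂(G − d)` at `x`: the `W`-path avoids `d`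
  have hvM' : v ∈ M2 (endsD ends d) r s (assignX ends x ρ) := by
    rcases mem_M2_iff.1 hvM with h1 | h1
    · exact mem_M2_iff.2 (Or.inl (conn_endsD_of_not_conn h1
        (fun hc => hM (mem_M2_iff.2 (Or.inl hc)))))
    · exact mem_M2_iff.2 (Or.inr (conn_endsD_of_not_conn h1
        (fun hc => hM (mem_M2_iff.2 (Or.inr hc)))))
  rw [M2_endsD_assignX' hr hs hρD hT hF] at hvM'
  obtain ⟨_, hMρ, _⟩ := mem_RepD.1 hρD
  have hvT : v ∈ (↑(unionT x.1) : Set V) := by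
    rcases hvM' with h1 | h1
    · exfalso
      rcases hMρ v h1 with h2 | h2
      · exact hvr h2
      · exact hvs h2
    · exact h1
  -- hence `v ∈ M₂(G − d) ⊆ M₂(G)` at `x'`
  have hvM'' : v ∈ M2 ends r s (assignX ends x' ρ) := by
    have h0 : v ∈ M2 (endsD ends d) r s (assignX ends x' ρ) := by
      rw [M2_endsD_assignX' hr hs hρD hT' hF']
      exact Or.inr (Finset.mem_coe.2 (unionT_mono hxx'.1 (Finset.mem_coe.1 hvT)))
    rcases mem_M2_iff.1 h0 with h1 | h1
    · exact mem_M2_iff.2 (Or.inl (conn_of_conn_endsD h1))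
    · exact mem_M2_iff.2 (Or.inr (conn_of_conn_endsD h1))
  -- `v ∉ K₂(G − d)` at `x`, so its `Y`-connection passes through `d`
  have hvK' : v ∉ K2 (endsD ends d) r s (assignX ends x ρ) := by
    rw [K2_endsD_assignX' hr hs hρD hT hF]
    exact fun h => h.2 hvT
  have hdv : Conn ends (assignX ends x ρ) d v := by
    rcases mem_K2_iff.1 hvK with h1 | h1
    · by_cases hrd : Conn ends (assignX ends x ρ) r d
      · exact conn_trans (conn_symm hrd) h1
      · exact absurd (mem_K2_iff.2 (Or.inl (conn_endsD_of_not_conn h1 hrd))) hvK'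
    · by_cases hsd : Conn ends (assignX ends x ρ) s d
      · exact conn_trans (conn_symm hsd) h1
      · exact absurd (mem_K2_iff.2 (Or.inr (conn_endsD_of_not_conn h1 hsd))) hvK'
  obtain ⟨e, u, hends, he, hvu⟩ := conn_d_decomp hvd (conn_symm hdv)
  -- `u ∉ K₂(G − d)` at `x` (else `v` would be), so `u ~_Y v` in `G − d` at `x'`, and the edge
  -- `d–u` is `Y` at `x'`
  have huK : u ∉ K2 (endsD ends d) r s (assignX ends x ρ) := by
    intro huK
    apply hvK'
    rcases mem_K2_iff.1 huK with h1 | h1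
    · exact mem_K2_iff.2 (Or.inl (conn_trans h1 (conn_symm hvu)))
    · exact mem_K2_iff.2 (Or.inr (conn_trans h1 (conn_symm hvu)))
  have hvu' : Conn (endsD ends d) (assignX ends x' ρ) u v :=
    conn_endsD_assignX_mono hr hs hρ hxx' hx hx' huK (conn_symm hvu)
  have he' : assignX ends x' ρ e = true :=
    assignX_d_edge_true_of_le hr hs hρ hxx' hx hx' hends hM' huK he
  have hdv' : Conn ends (assignX ends x' ρ) d v :=
    conn_trans (conn_of_openAdj ⟨e, he', hends⟩) (conn_of_conn_endsD hvu')
  have hvK'' : v ∈ K2 ends r s (assignX ends x' ρ) := by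
    rcases mem_K2_iff.1 hK' with h1 | h1
    · exact mem_K2_iff.2 (Or.inl (conn_trans h1 hdv'))
    · exact mem_K2_iff.2 (Or.inr (conn_trans h1 hdv'))
  exact hD' v hvr hvs hvd hvK'' hvM''

/-- **The hub–dead-end predicate is a down-set of the cube.** -/
theorem hubDead_assignX_anti (hr : d ≠ r) (hs : d ≠ s) (hpd : p ≠ d) (hqd : q ≠ d)
    {ρ : Config E} (hρ : ρ ∈ RepP ends p q r s d) {x x' : Finset (Finset V) × Finset E}
    (hxx' : x ≤ x') (hx : x ∈ cubeP ends d r s ρ) (hx' : x' ∈ cubeP ends d r s ρ)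
    (h : HubDead ends p q r s d (assignX ends x' ρ)) :
    HubDead ends p q r s d (assignX ends x ρ) := by
  obtain ⟨hsep', hD', hK', hM', hrs', hdef'⟩ := h
  obtain ⟨hρD, _⟩ := mem_RepP.1 hρ
  obtain ⟨hT, hF⟩ := mem_cubeP.1 hx
  have hK : d ∈ K2 ends r s (assignX ends x ρ) := mem_K2_assignX_anti hr hs hρ hxx' hx hx' hK'
  have hM : d ∉ M2 ends r s (assignX ends x ρ) :=
    fun hm => hM' (mem_M2_assignX_mono hr hs hρ hxx' hx hx' hm)
  have hrs : Conn ends (assignX ends x ρ) r s := conn_rs_assignX_anti' hr hs hρ hxx' hx hx' hrs'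
  have hdef : hubW ends d p q (assignX ends x ρ) ∨ deadWb ends d r s (assignX ends x ρ) := by
    rcases hdef' with h1 | h1
    · exact Or.inl (hubW_assignX_anti hr hs hpd hqd hρ hxx' hx hx' h1)
    · exact Or.inr (deadWb_assignX_anti hr hs hρ hxx' hx' hx hM' h1)
  have hsep : sep2 ends p q r s (assignX ends x ρ) := by
    refine sep2_of_not_mem_M2_of_not_hubY hpd hqd (sep2_endsD_assignX' hr hs hρD hT hF) hM ?_
    intro hY
    exact not_mem_K2_of_hubY hsep' (hubY_assignX_mono hr hs hpd hqd hρ hxx' hx hx' hY) hK'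
  exact ⟨hsep, DOne_assignX_of_le hr hs hρ hxx' hx hx' hK' hM' hM hD', hK, hM, hrs, hdef⟩

end Cube

end NoPocket

end Summit.Ventures.PercRepro2
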